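import Mathlib.RingTheory.Polynomial.Cyclotomic.Roots
import Mathlib.RingTheory.Polynomial.Cyclotomic.Expand
import Mathlib.RingTheory.Polynomial.Cyclotomic.Eval
import Mathlib.RingTheory.AdjoinRoot
import Mathlib.RingTheory.RootsOfUnity.Complex
import Mathlib.FieldTheory.KummerExtension
import Mathlib.NumberTheory.Wilson
import Summits.HodgeConjecture.CorCM.CyclotomicFourPIntegers
import HarnessLib

/-!
# The order `ℤ[ζ_{2^{a+1}p}] = ℤ[X]/(Φ_{2^{a+1}p})`: the ideal `(p, X^{2^a} + 1)` above `p`, its reduction maps, and the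
# units `p/(1 + ζ^{2^a})^{p−1}`, `ρ(1 + ζ^{2^a})/(1 + ζ^{2^a})`

COR-CM (cell `pub-hodgecm2`), binder seat b04 (gen 25), count-neutral claim CYCLIC-SEMIDIRECT-TWO-POWER, part IIIa: the
`2^{a+1}`-analogue of `CorCM/CyclotomicFourPIntegers` (`a = 1`), for the norm descent «a primitive `2^{a+1}`-th root of unity is
not a norm from `ℚ(ζ_{2^{a+1}p})` to the fixed field of `ζ ↦ ζ^{2p−1}` when `p ≡ 2^{a+1} + 1 (mod 2^{a+2})`» (part IIIb).
Mathlib (+ `CorCM/CyclotomicFourPIntegers` for `ringHom_ext`) only.  KERNEL ONLY: theorems; no definition, no named fact, no `sorry`.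

Throughout `p` is an odd prime, `Λ = AdjoinRoot (cyclotomic (2^{a+1} p) ℤ)` with generator `μ`, `ζ = e^{2πi/2^{a+1}p} ∈ ℂ`,
`g = 1 + μ^{2^a}`, `η = −μ^{2^a}` (a primitive `p`-th root of unity), `R = 𝔽_p[X]/(X^{2^a} + 1)` (the reduction of `Λ` modulo
`g`: `Φ_{2^{a+1}p} ≡ (X^{2^a}+1)^{p−1} (mod p)`), `s ∈ 𝔽_p` with `s^{2^a} = −1`.

* §1 evaluation `Λ → ℂ` and injectivity; `isPrimitiveRoot_root`, `root_pow_eq_neg_one` (`μ^{2^a p} = −1`), `isPrimitiveRoot_eta`,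
  `eval₂_root_pow_cyclotomic` (`ringHom_ext` is reused from `CorCM/CyclotomicFourPIntegers`).
* §2 `prime_eq_prod`, **`prime_eq_pow_mul`** (`p = g^{p−1}·ε`), `one_add_root_pow_ne_zero`, `one_add_root_pow_eq`
  (`ρ̃(g) = g ε₂`, `ε₂(−η) = 1`).
* §3 the reductions `π_R : Λ → R` (`cyclotomic_two_pow_eq`, `eval₂_cyclotomic_R`, **`exists_eq_mul_of_liftR_eq_zero`**
  (kernel `= gΛ`), `liftR_eq_zero_of_sq` (`R` is reduced)) and `π_s : Λ → 𝔽_p` (`eval₂_cyclotomic_s`, `lift_eta`,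
  `lift_eps_ne_zero`).

## References

* [Washington1997] L. C. Washington, *Introduction to Cyclotomic Fields*, Lemma 1.4, Prop. 2.8, Thm. 2.13.
* [FeinGordonSmith1971] B. Fein, B. Gordon, J. H. Smith, J. Number Theory 3 (1971), 310–315.
-/

noncomputable section

open Polynomial

namespace Summit.HodgeConjecture.CorCM.CyclotomicTwoPowerP

variable {p a : ℕ}

/-! ## §1 The evaluation `ℤ[X]/(Φ_{2^{a+1}p}) → ℂ` and its consequences -/

section Eval

/-- `ζ = e^{2πi/2^{a+1}p}` is a root of `Φ_{2^{a+1}p}`, read through `ℤ → ℂ`. [folklore] -/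
theorem eval₂_cyclotomic_exp (hp : 0 < p) :
    (cyclotomic (2 ^ (a + 1) * p) ℤ).eval₂ (algebraMap ℤ ℂ)
      (Complex.exp (2 * Real.pi * Complex.I / (2 ^ (a + 1) * p : ℕ))) = 0 := by
  have hζ := Complex.isPrimitiveRoot_exp (2 ^ (a + 1) * p) (by positivity)
  haveI : NeZero (2 ^ (a + 1) * p) := ⟨by positivity⟩
  rw [eval₂_eq_eval_map, map_cyclotomic, ← IsRoot.def, isRoot_cyclotomic_iff]
  exact hζ

/-- `P(ζ) = 0 ⟹ Φ_{2^{a+1}p} ∣ P`. [cite: Washington1997, Lemma 1.4] -/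
theorem mk_eq_zero_of_aeval_eq_zero (hp : 0 < p) (P : ℤ[X])
    (hP : aeval (Complex.exp (2 * Real.pi * Complex.I / (2 ^ (a + 1) * p : ℕ))) P = 0) :
    AdjoinRoot.mk (cyclotomic (2 ^ (a + 1) * p) ℤ) P = 0 := by
  have hζ := Complex.isPrimitiveRoot_exp (2 ^ (a + 1) * p) (by positivity)
  rw [AdjoinRoot.mk_eq_zero, cyclotomic_eq_minpoly hζ (by positivity)]
  exact minpoly.isIntegrallyClosed_dvd (hζ.isIntegral (by positivity)) hP

/-- The evaluation map on classes. [folklore] -/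
theorem lift_exp_mk (hp : 0 < p) (P : ℤ[X]) :
    AdjoinRoot.lift (algebraMap ℤ ℂ) _ (eval₂_cyclotomic_exp (a := a) hp) (AdjoinRoot.mk (cyclotomic (2 ^ (a + 1) * p) ℤ) P) =
      aeval (Complex.exp (2 * Real.pi * Complex.I / (2 ^ (a + 1) * p : ℕ))) P := by
  rw [AdjoinRoot.lift_mk, aeval_def]

/-- **Injectivity of the evaluation.** [cite: Washington1997, Lemma 1.4] -/
theorem lift_exp_injective (hp : 0 < p) :
    Function.Injective (AdjoinRoot.lift (algebraMap ℤ ℂ) _ (eval₂_cyclotomic_exp (a := a) hp) :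
      AdjoinRoot (cyclotomic (2 ^ (a + 1) * p) ℤ) →+* ℂ) := by
  refine (injective_iff_map_eq_zero _).2 fun Z hZ => ?_
  induction Z using AdjoinRoot.induction_on with
  | ih P =>
    rw [lift_exp_mk hp] at hZ
    exact mk_eq_zero_of_aeval_eq_zero hp P hZ

/-- `μ` is a primitive `2^{a+1}p`-th root of unity in `Λ`. [folklore] -/
theorem isPrimitiveRoot_root (hp : 0 < p) :
    IsPrimitiveRoot (AdjoinRoot.root (cyclotomic (2 ^ (a + 1) * p) ℤ)) (2 ^ (a + 1) * p) := by
  refine IsPrimitiveRoot.of_map_of_injective (f := AdjoinRoot.lift (algebraMap ℤ ℂ) _ (eval₂_cyclotomic_exp hp)) ?_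
    (lift_exp_injective hp)
  rw [AdjoinRoot.lift_root]
  exact Complex.isPrimitiveRoot_exp (2 ^ (a + 1) * p) (by positivity)

/-- `Λ` is a domain. [folklore] -/
theorem isDomain (hp : 0 < p) : IsDomain (AdjoinRoot (cyclotomic (2 ^ (a + 1) * p) ℤ)) :=
  AdjoinRoot.isDomain_of_prime (cyclotomic.irreducible (by positivity)).prime

/-- `μ^{2^a p} = −1`. [folklore] -/
theorem root_pow_eq_neg_one (hp : 0 < p) :
    AdjoinRoot.root (cyclotomic (2 ^ (a + 1) * p) ℤ) ^ (2 ^ a * p) = -1 := by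
  haveI := isDomain (a := a) hp
  have hμ := isPrimitiveRoot_root (a := a) hp
  have h2a : 2 ^ a * p * 2 = 2 ^ (a + 1) * p := by rw [pow_succ]; ring
  have h1 : AdjoinRoot.root (cyclotomic (2 ^ (a + 1) * p) ℤ) ^ (2 ^ a * p) *
      AdjoinRoot.root (cyclotomic (2 ^ (a + 1) * p) ℤ) ^ (2 ^ a * p) = 1 := by
    rw [← pow_two, ← pow_mul, h2a, hμ.pow_eq_one]
  have hne : AdjoinRoot.root (cyclotomic (2 ^ (a + 1) * p) ℤ) ^ (2 ^ a * p) ≠ 1 := by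
    intro h
    have := Nat.le_of_dvd (by positivity) (hμ.dvd_of_pow_eq_one _ h)
    have : 0 < 2 ^ a * p := by positivity
    omega
  rcases mul_self_eq_one_iff.1 h1 with h | h
  · exact absurd h hne
  · exact h

/-- **`η = −μ^{2^a}` is a primitive `p`-th root of unity** (`p` odd). [folklore] -/
theorem isPrimitiveRoot_eta (hp : p.Prime) (hp2 : p ≠ 2) :
    IsPrimitiveRoot (-(AdjoinRoot.root (cyclotomic (2 ^ (a + 1) * p) ℤ)) ^ 2 ^ a) p := by
  haveI := isDomain (a := a) hp.pos
  haveI : Fact p.Prime := ⟨hp⟩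
  have hμ := isPrimitiveRoot_root (a := a) hp.pos
  have hodd : Odd p := hp.odd_of_ne_two hp2
  have hηp : (-(AdjoinRoot.root (cyclotomic (2 ^ (a + 1) * p) ℤ)) ^ 2 ^ a) ^ p = 1 := by
    rw [neg_pow, hodd.neg_one_pow, ← pow_mul, root_pow_eq_neg_one hp.pos, neg_mul, one_mul, neg_neg]
  have hη1 : -(AdjoinRoot.root (cyclotomic (2 ^ (a + 1) * p) ℤ)) ^ 2 ^ a ≠ 1 := by
    intro h
    have h2 : AdjoinRoot.root (cyclotomic (2 ^ (a + 1) * p) ℤ) ^ 2 ^ a = -1 := neg_eq_iff_eq_neg.1 h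
    have h4 : AdjoinRoot.root (cyclotomic (2 ^ (a + 1) * p) ℤ) ^ 2 ^ (a + 1) = 1 := by
      rw [show AdjoinRoot.root (cyclotomic (2 ^ (a + 1) * p) ℤ) ^ 2 ^ (a + 1) =
        (AdjoinRoot.root (cyclotomic (2 ^ (a + 1) * p) ℤ) ^ 2 ^ a) ^ 2 by rw [← pow_mul, ← pow_succ], h2, neg_one_sq]
    have := Nat.le_of_dvd (by positivity) (hμ.dvd_of_pow_eq_one _ h4)
    have h2le := hp.two_le
    have : 0 < 2 ^ (a + 1) := by positivity
    nlinarith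
  have hord : orderOf (-(AdjoinRoot.root (cyclotomic (2 ^ (a + 1) * p) ℤ)) ^ 2 ^ a) = p := orderOf_eq_prime hηp hη1
  have key := IsPrimitiveRoot.orderOf (-(AdjoinRoot.root (cyclotomic (2 ^ (a + 1) * p) ℤ)) ^ 2 ^ a)
  rwa [hord] at key

/-- `Φ(μ^b) = 0` in `Λ` for `b` coprime to `2^{a+1}p`. [folklore] -/
theorem eval₂_root_pow_cyclotomic (hp : 0 < p) {b : ℕ} (hb : b.Coprime (2 ^ (a + 1) * p)) :
    (cyclotomic (2 ^ (a + 1) * p) ℤ).eval₂ (algebraMap ℤ (AdjoinRoot (cyclotomic (2 ^ (a + 1) * p) ℤ)))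
      (AdjoinRoot.root (cyclotomic (2 ^ (a + 1) * p) ℤ) ^ b) = 0 := by
  apply lift_exp_injective hp
  haveI : NeZero (2 ^ (a + 1) * p) := ⟨by positivity⟩
  have hζb := (Complex.isPrimitiveRoot_exp (2 ^ (a + 1) * p) (by positivity)).pow_of_coprime b hb
  rw [map_zero, hom_eval₂, map_pow, AdjoinRoot.lift_root, eval₂_eq_eval_map, ← IsRoot.def]
  have : ((AdjoinRoot.lift (algebraMap ℤ ℂ) (Complex.exp (2 * Real.pi * Complex.I / (2 ^ (a + 1) * p : ℕ)))
      (eval₂_cyclotomic_exp hp)).comp (algebraMap ℤ (AdjoinRoot (cyclotomic (2 ^ (a + 1) * p) ℤ)))) = algebraMap ℤ ℂ :=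
    Subsingleton.elim _ _
  rw [this, map_cyclotomic, isRoot_cyclotomic_iff]
  exact hζb

end Eval

/-! ## §2 `p = (1 + μ^{2^a})^{p−1} · ε` -/

section Units

/-- **`p = ∏_{j=1}^{p−1} (1 − η^j)`** for `η = −μ^{2^a}`. [cite: Washington1997, Lemma 1.4] -/
theorem prime_eq_prod (hp : p.Prime) (hp2 : p ≠ 2) :
    ((p : ℕ) : AdjoinRoot (cyclotomic (2 ^ (a + 1) * p) ℤ)) =
      ∏ j ∈ Finset.range (p - 1), (1 - (-(AdjoinRoot.root (cyclotomic (2 ^ (a + 1) * p) ℤ)) ^ 2 ^ a) ^ (j + 1)) := by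
  haveI := isDomain (a := a) hp.pos
  haveI : Fact p.Prime := ⟨hp⟩
  set η := -(AdjoinRoot.root (cyclotomic (2 ^ (a + 1) * p) ℤ)) ^ 2 ^ a with hη_def
  have hη := isPrimitiveRoot_eta (a := a) hp hp2
  have hprod := X_pow_sub_C_eq_prod (R := AdjoinRoot (cyclotomic (2 ^ (a + 1) * p) ℤ)) hη hp.pos (one_pow p)
  simp only [map_one, mul_one] at hprod
  have hr : Finset.range p = Finset.range (p - 1 + 1) := by rw [Nat.sub_add_cancel hp.one_le]
  rw [hr, Finset.prod_range_succ', pow_zero, map_one] at hprod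
  have hcyc := cyclotomic_prime_mul_X_sub_one (AdjoinRoot (cyclotomic (2 ^ (a + 1) * p) ℤ)) p
  rw [hprod] at hcyc
  have hX1 : (X - 1 : (AdjoinRoot (cyclotomic (2 ^ (a + 1) * p) ℤ))[X]) ≠ 0 := X_sub_C_ne_zero 1
  have hΦ : cyclotomic p (AdjoinRoot (cyclotomic (2 ^ (a + 1) * p) ℤ)) =
      ∏ j ∈ Finset.range (p - 1), (X - C (η ^ (j + 1))) := mul_right_cancel₀ hX1 hcyc
  have h1 := congrArg (eval 1) hΦ
  rw [eval_one_cyclotomic_prime, eval_prod] at h1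
  simp only [eval_sub, eval_X, eval_C] at h1
  exact h1

/-- **`p = (1 + μ^{2^a})^{p−1} · ε`**, `ε = ∏_{j=1}^{p−1} (1 + η + ⋯ + η^{j−1})`. [cite: Washington1997, Prop. 2.8] -/
theorem prime_eq_pow_mul (hp : p.Prime) (hp2 : p ≠ 2) :
    ((p : ℕ) : AdjoinRoot (cyclotomic (2 ^ (a + 1) * p) ℤ)) =
      (1 + AdjoinRoot.root (cyclotomic (2 ^ (a + 1) * p) ℤ) ^ 2 ^ a) ^ (p - 1) *
        ∏ j ∈ Finset.range (p - 1), ∑ m ∈ Finset.range (j + 1),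
          (-(AdjoinRoot.root (cyclotomic (2 ^ (a + 1) * p) ℤ)) ^ 2 ^ a) ^ m := by
  rw [prime_eq_prod hp hp2]
  have hfac : ∀ j : ℕ, (1 - (-(AdjoinRoot.root (cyclotomic (2 ^ (a + 1) * p) ℤ)) ^ 2 ^ a) ^ (j + 1)) =
      (1 + AdjoinRoot.root (cyclotomic (2 ^ (a + 1) * p) ℤ) ^ 2 ^ a) *
        ∑ m ∈ Finset.range (j + 1), (-(AdjoinRoot.root (cyclotomic (2 ^ (a + 1) * p) ℤ)) ^ 2 ^ a) ^ m := fun j => by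
    rw [← mul_neg_geom_sum, sub_neg_eq_add]
  simp_rw [hfac]
  rw [Finset.prod_mul_distrib, Finset.prod_const, Finset.card_range]

/-- `1 + μ^{2^a} ≠ 0` in `Λ`. [folklore] -/
theorem one_add_root_pow_ne_zero (hp : p.Prime) (hp2 : p ≠ 2) :
    (1 + AdjoinRoot.root (cyclotomic (2 ^ (a + 1) * p) ℤ) ^ 2 ^ a) ≠ 0 := by
  haveI := isDomain (a := a) hp.pos
  intro h
  have hp0 : ((p : ℕ) : AdjoinRoot (cyclotomic (2 ^ (a + 1) * p) ℤ)) = 0 := by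
    rw [prime_eq_pow_mul hp hp2, h, zero_pow (by have := hp.two_le; omega), zero_mul]
  have := congrArg (AdjoinRoot.lift (algebraMap ℤ ℂ) _ (eval₂_cyclotomic_exp hp.pos)) hp0
  rw [map_natCast, map_zero, Nat.cast_eq_zero] at this
  exact hp.ne_zero this

/-- `ρ̃(g) = 1 + (μ^{2p−1})^{2^a} = g · ε₂`, `ε₂ = 1 + η + ⋯ + η^{p−2}`, `ε₂ · (−η) = 1`. [folklore] -/
theorem one_add_root_pow_eq (hp : p.Prime) (hp2 : p ≠ 2) :
    1 + (AdjoinRoot.root (cyclotomic (2 ^ (a + 1) * p) ℤ) ^ (2 * p - 1)) ^ 2 ^ a =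
      (1 + AdjoinRoot.root (cyclotomic (2 ^ (a + 1) * p) ℤ) ^ 2 ^ a) *
        ∑ m ∈ Finset.range (p - 1), (-(AdjoinRoot.root (cyclotomic (2 ^ (a + 1) * p) ℤ)) ^ 2 ^ a) ^ m ∧
    (∑ m ∈ Finset.range (p - 1), (-(AdjoinRoot.root (cyclotomic (2 ^ (a + 1) * p) ℤ)) ^ 2 ^ a) ^ m) *
        (-(-(AdjoinRoot.root (cyclotomic (2 ^ (a + 1) * p) ℤ)) ^ 2 ^ a)) = 1 := by
  haveI := isDomain (a := a) hp.pos
  set μ := AdjoinRoot.root (cyclotomic (2 ^ (a + 1) * p) ℤ) with hμ_def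
  set η := -μ ^ 2 ^ a with hη_def
  have hη := isPrimitiveRoot_eta (a := a) hp hp2
  have hev : Even (p - 1) := hp.even_sub_one hp2
  have h2p := root_pow_eq_neg_one (a := a) hp.pos
  have h2 := hp.two_le
  have hexp : (2 * p - 1) * 2 ^ a = 2 ^ a * p + 2 ^ a * (p - 1) := by
    zify [show 1 ≤ 2 * p by omega, hp.one_le]; ring
  have e1 : (μ ^ (2 * p - 1)) ^ 2 ^ a = μ ^ (2 ^ a * p) * μ ^ (2 ^ a * (p - 1)) := by
    rw [← pow_mul, ← pow_add, hexp]
  have hsq : (μ ^ (2 * p - 1)) ^ 2 ^ a = -η ^ (p - 1) := by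
    rw [e1, hμ_def, h2p, hη_def, neg_pow, hev.neg_one_pow, one_mul, ← pow_mul, neg_one_mul]
  have hgeom : ∑ m ∈ Finset.range p, η ^ m = 0 := hη.geom_sum_eq_zero hp.one_lt
  have hgeom' : ∑ m ∈ Finset.range (p - 1), η ^ m = -η ^ (p - 1) := by
    have hr : Finset.range p = Finset.range (p - 1 + 1) := by rw [Nat.sub_add_cancel hp.one_le]
    rw [hr, Finset.sum_range_succ] at hgeom
    linear_combination hgeom
  refine ⟨?_, ?_⟩
  · rw [hsq, ← sub_eq_add_neg, ← mul_neg_geom_sum, hη_def, sub_neg_eq_add]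
  · rw [hgeom', neg_mul_neg, ← pow_succ, Nat.sub_add_cancel hp.one_le, hη.pow_eq_one]

end Units

/-! ## §3 The reductions `π_R : Λ → 𝔽_p[X]/(X^{2^a}+1)` and `π_s : Λ → 𝔽_p` -/

section Reduction

/-- `Φ_{2^{a+1}} = X^{2^a} + 1`. [folklore] -/
theorem cyclotomic_two_pow_eq (R : Type*) [CommRing R] : cyclotomic (2 ^ (a + 1)) R = X ^ 2 ^ a + 1 := by
  have := cyclotomic_prime_pow_eq_geom_sum (R := R) (n := a) Nat.prime_two
  rw [Finset.sum_range_succ, Finset.sum_range_one, pow_zero, pow_one] at this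
  rw [this, add_comm]

/-- `Φ_{2^{a+1}p} ≡ (X^{2^a} + 1)^{p−1} (mod p)`. [cite: Washington1997, Thm. 2.13] -/
theorem map_cyclotomic_eq (hp : p.Prime) (hp2 : p ≠ 2) :
    (cyclotomic (2 ^ (a + 1) * p) ℤ).map (Int.castRingHom (ZMod p)) = (X ^ 2 ^ a + 1) ^ (p - 1) := by
  haveI : Fact p.Prime := ⟨hp⟩
  have h2 : ¬ p ∣ 2 ^ (a + 1) := fun h =>
    hp2 ((Nat.prime_dvd_prime_iff_eq hp Nat.prime_two).1 (hp.dvd_of_dvd_pow h))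
  rw [map_cyclotomic_int, cyclotomic_mul_prime_eq_pow_of_not_dvd (ZMod p) h2, cyclotomic_two_pow_eq]

/-- `Φ_{2^{a+1}p}(X) = 0` in `R = 𝔽_p[X]/(X^{2^a}+1)`. [folklore] -/
theorem eval₂_cyclotomic_R (hp : p.Prime) (hp2 : p ≠ 2) :
    (cyclotomic (2 ^ (a + 1) * p) ℤ).eval₂ (Int.castRingHom (AdjoinRoot (X ^ 2 ^ a + 1 : (ZMod p)[X])))
      (AdjoinRoot.root (X ^ 2 ^ a + 1 : (ZMod p)[X])) = 0 := by
  have hc : Int.castRingHom (AdjoinRoot (X ^ 2 ^ a + 1 : (ZMod p)[X])) =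
      (algebraMap (ZMod p) _).comp (Int.castRingHom (ZMod p)) := Subsingleton.elim _ _
  rw [hc, ← eval₂_map, map_cyclotomic_eq hp hp2, eval₂_pow, ← aeval_def, AdjoinRoot.aeval_eq, AdjoinRoot.mk_self,
    zero_pow]
  have := hp.two_le; omega

/-- `Φ_{2^{a+1}p}(s) = 0` in `𝔽_p` when `s^{2^a} = −1`. [folklore] -/
theorem eval₂_cyclotomic_s (hp : p.Prime) (hp2 : p ≠ 2) {s : ZMod p} (hs : s ^ 2 ^ a = -1) :
    (cyclotomic (2 ^ (a + 1) * p) ℤ).eval₂ (Int.castRingHom (ZMod p)) s = 0 := by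
  rw [eval₂_eq_eval_map, map_cyclotomic_eq hp hp2, eval_pow, eval_add, eval_pow, eval_X, eval_one, hs, neg_add_cancel,
    zero_pow]
  have := hp.two_le; omega

/-- `π_R` on classes: `π_R(P mod Φ) = (P mod p) mod (X^{2^a}+1)`. [folklore] -/
theorem liftR_mk (hp : p.Prime) (hp2 : p ≠ 2) (P : ℤ[X]) :
    AdjoinRoot.lift (Int.castRingHom _) (AdjoinRoot.root (X ^ 2 ^ a + 1 : (ZMod p)[X])) (eval₂_cyclotomic_R hp hp2)
        (AdjoinRoot.mk (cyclotomic (2 ^ (a + 1) * p) ℤ) P) =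
      AdjoinRoot.mk (X ^ 2 ^ a + 1 : (ZMod p)[X]) (P.map (Int.castRingHom (ZMod p))) := by
  rw [AdjoinRoot.lift_mk, ← AdjoinRoot.aeval_eq, aeval_def, eval₂_map]
  congr 1

/-- **The kernel of `π_R` is `gΛ`**, `g = 1 + μ^{2^a}` (as `p = g^{p−1} ε`). [cite: Washington1997, Thm. 2.13] -/
theorem exists_eq_mul_of_liftR_eq_zero (hp : p.Prime) (hp2 : p ≠ 2) (Z : AdjoinRoot (cyclotomic (2 ^ (a + 1) * p) ℤ))
    (h : AdjoinRoot.lift (Int.castRingHom _) (AdjoinRoot.root (X ^ 2 ^ a + 1 : (ZMod p)[X]))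
      (eval₂_cyclotomic_R hp hp2) Z = 0) :
    ∃ Z' : AdjoinRoot (cyclotomic (2 ^ (a + 1) * p) ℤ),
      Z = (1 + AdjoinRoot.root (cyclotomic (2 ^ (a + 1) * p) ℤ) ^ 2 ^ a) * Z' := by
  haveI : Fact p.Prime := ⟨hp⟩
  induction Z using AdjoinRoot.induction_on with
  | ih P =>
  rw [liftR_mk hp hp2, AdjoinRoot.mk_eq_zero] at h
  obtain ⟨Q₂, hQ₂⟩ := h
  obtain ⟨Q, rfl⟩ := map_surjective (Int.castRingHom (ZMod p)) (ZMod.ringHom_surjective _) Q₂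
  have hdiff : (P - (X ^ 2 ^ a + 1) * Q).map (Int.castRingHom (ZMod p)) = 0 := by
    rw [Polynomial.map_sub, Polynomial.map_mul, hQ₂]
    simp
  have hdvd : C (p : ℤ) ∣ P - (X ^ 2 ^ a + 1) * Q := by
    rw [C_dvd_iff_dvd_coeff]
    intro i
    have hi := congrArg (fun q : (ZMod p)[X] => q.coeff i) hdiff
    simp only [coeff_map, coeff_zero, eq_intCast] at hi
    exact (ZMod.intCast_zmod_eq_zero_iff_dvd _ p).1 hi
  obtain ⟨R', hR⟩ := hdvd
  have hP : P = (X ^ 2 ^ a + 1) * Q + C (p : ℤ) * R' := by rw [← hR]; ring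
  have hpg := prime_eq_pow_mul (a := a) hp hp2
  refine ⟨AdjoinRoot.mk _ Q + (1 + AdjoinRoot.root (cyclotomic (2 ^ (a + 1) * p) ℤ) ^ 2 ^ a) ^ (p - 2) *
    (∏ j ∈ Finset.range (p - 1), ∑ m ∈ Finset.range (j + 1),
      (-(AdjoinRoot.root (cyclotomic (2 ^ (a + 1) * p) ℤ)) ^ 2 ^ a) ^ m) * AdjoinRoot.mk _ R', ?_⟩
  rw [hP, map_add, map_mul, map_mul, map_add, map_pow, AdjoinRoot.mk_X, map_one, AdjoinRoot.mk_C, map_natCast, hpg]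
  have hsplit : (1 + AdjoinRoot.root (cyclotomic (2 ^ (a + 1) * p) ℤ) ^ 2 ^ a) ^ (p - 1) =
      (1 + AdjoinRoot.root (cyclotomic (2 ^ (a + 1) * p) ℤ) ^ 2 ^ a) ^ (p - 2) *
        (1 + AdjoinRoot.root (cyclotomic (2 ^ (a + 1) * p) ℤ) ^ 2 ^ a) := by
    rw [← pow_succ]; congr 1; have := hp.two_le; omega
  rw [hsplit]
  ring

/-- **`R = 𝔽_p[X]/(X^{2^a}+1)` is reduced**: `x² = 0 ⟹ x = 0` (`X^{2^a}+1 ∣ X^{2^{a+1}} − 1` is separable mod `p`).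
[folklore] -/
theorem eq_zero_of_sq_eq_zero_R (hp : p.Prime) (hp2 : p ≠ 2) (x : AdjoinRoot (X ^ 2 ^ a + 1 : (ZMod p)[X]))
    (hx : x ^ 2 = 0) : x = 0 := by
  haveI : Fact p.Prime := ⟨hp⟩
  induction x using AdjoinRoot.induction_on with
  | ih P =>
  rw [← map_pow, AdjoinRoot.mk_eq_zero] at hx
  rw [AdjoinRoot.mk_eq_zero]
  have hsep : (X ^ 2 ^ (a + 1) - 1 : (ZMod p)[X]).Separable := by
    rw [← C_1]
    refine separable_X_pow_sub_C 1 ?_ one_ne_zero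
    rw [Nat.cast_pow, Nat.cast_ofNat]
    refine pow_ne_zero _ ?_
    rw [Ne, show (2 : ZMod p) = ((2 : ℕ) : ZMod p) by norm_num, ZMod.natCast_eq_zero_iff]
    exact fun h => hp2 ((Nat.prime_dvd_prime_iff_eq hp Nat.prime_two).1 h)
  have hdvd : (X ^ 2 ^ a + 1 : (ZMod p)[X]) ∣ X ^ 2 ^ (a + 1) - 1 :=
    ⟨X ^ 2 ^ a - 1, by rw [pow_succ, pow_mul]; ring⟩
  have hsq : Squarefree (X ^ 2 ^ a + 1 : (ZMod p)[X]) := (hsep.of_dvd hdvd).squarefree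
  exact hsq.isRadical 2 P hx

/-- `π_R(g) = 0`. [folklore] -/
theorem liftR_one_add_root_pow (hp : p.Prime) (hp2 : p ≠ 2) :
    AdjoinRoot.lift (Int.castRingHom _) (AdjoinRoot.root (X ^ 2 ^ a + 1 : (ZMod p)[X])) (eval₂_cyclotomic_R hp hp2)
      (1 + AdjoinRoot.root (cyclotomic (2 ^ (a + 1) * p) ℤ) ^ 2 ^ a) = 0 := by
  rw [map_add, map_one, map_pow, AdjoinRoot.lift_root]
  have h : AdjoinRoot.mk (X ^ 2 ^ a + 1 : (ZMod p)[X]) (X ^ 2 ^ a + 1) = 0 := AdjoinRoot.mk_self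
  rw [map_add, map_pow, AdjoinRoot.mk_X, map_one] at h
  exact (add_comm _ _).trans h

/-- `X^{2^{a+1}} = 1` in `R`. [folklore] -/
theorem rootR_pow : AdjoinRoot.root (X ^ 2 ^ a + 1 : (ZMod p)[X]) ^ 2 ^ (a + 1) = 1 := by
  have h : AdjoinRoot.mk (X ^ 2 ^ a + 1 : (ZMod p)[X]) (X ^ 2 ^ a + 1) = 0 := AdjoinRoot.mk_self
  rw [map_add, map_pow, AdjoinRoot.mk_X, map_one] at h
  have h' : AdjoinRoot.root (X ^ 2 ^ a + 1 : (ZMod p)[X]) ^ 2 ^ a = -1 := eq_neg_of_add_eq_zero_left h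
  rw [pow_succ, pow_mul, h', neg_one_sq]

/-- `π_s(η) = 1`. [folklore] -/
theorem lift_eta (hp : p.Prime) (hp2 : p ≠ 2) {s : ZMod p} (hs : s ^ 2 ^ a = -1) :
    AdjoinRoot.lift (Int.castRingHom (ZMod p)) s (eval₂_cyclotomic_s hp hp2 hs)
      (-(AdjoinRoot.root (cyclotomic (2 ^ (a + 1) * p) ℤ)) ^ 2 ^ a) = 1 := by
  rw [map_neg, map_pow, AdjoinRoot.lift_root, hs, neg_neg]

/-- **`π_s(ε) = (p−1)! ≠ 0`.** [folklore] -/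
theorem lift_eps_ne_zero (hp : p.Prime) (hp2 : p ≠ 2) {s : ZMod p} (hs : s ^ 2 ^ a = -1) :
    AdjoinRoot.lift (Int.castRingHom (ZMod p)) s (eval₂_cyclotomic_s hp hp2 hs)
      (∏ j ∈ Finset.range (p - 1), ∑ m ∈ Finset.range (j + 1),
        (-(AdjoinRoot.root (cyclotomic (2 ^ (a + 1) * p) ℤ)) ^ 2 ^ a) ^ m) ≠ 0 := by
  haveI : Fact p.Prime := ⟨hp⟩
  rw [map_prod]
  have hfac : ∀ j : ℕ, AdjoinRoot.lift (Int.castRingHom (ZMod p)) s (eval₂_cyclotomic_s hp hp2 hs)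
      (∑ m ∈ Finset.range (j + 1), (-(AdjoinRoot.root (cyclotomic (2 ^ (a + 1) * p) ℤ)) ^ 2 ^ a) ^ m) =
        ((j + 1 : ℕ) : ZMod p) := fun j => by
    rw [map_sum]
    simp_rw [map_pow, lift_eta hp hp2 hs, one_pow]
    simp
  simp_rw [hfac]
  rw [← Nat.cast_prod, Finset.prod_range_add_one_eq_factorial, ZMod.wilsons_lemma]
  exact neg_ne_zero.2 one_ne_zero

end Reduction

end Summit.HodgeConjecture.CorCM.CyclotomicTwoPowerP

end
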